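import Literature.AlgebraicGeometry.Motives.JacobianBrillNoetherLocusPoints
import Literature.AlgebraicGeometry.Motives.JacobianAbelJacobiSum
import Literature.AlgebraicGeometry.Motives.WeilJacobianDimension
import Literature.AlgebraicGeometry.Motives.CartierDivisorClassPullback
import Literature.AlgebraicGeometry.Motives.CartierDivisorEffective
import HarnessLib

/-!
# Step I of Lange's Lemma 4.4.4 (= Milne, *Jacobian Varieties*, Lemma 6.7) ASSEMBLED FROM ITS LEAVES:
# `aj_P(ι_a^♮ Θ₀) = a` on a dense open set of `a`, for `ι_a : Q ↦ a · α_P(Q)⁻¹`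

Layer `Literature/AlgebraicGeometry/Motives`, namespace `Literature.AlgebraicGeometry.Motives.Jacobian`.  THEOREMS ONLY; no definition,
no named fact, no instance.  Cell `hodgecm-mathlib` (D-0151), road G4 towards the interface row VI-8 (F-P2) as a theorem; letters of record
`G4.sockets.v5` §3′ (M″) (pen A-p04 (g17) ruling #6); architect ruling 08:19:17Z (road (E): multiplicity one by generic étaleness).
THIS FILE IS THE TOP OF THE (3a) DAG, KERNEL-CHECKED: it proves the letter (M″) from the LEAF LETTERS taken as explicit hypotheses, so
that every leaf author sees the exact socket it must fill (same device as `Motives/JacobianNormPullbackWeilDivOfLeaves`).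

## Statement (Milne JV Lemma 6.7 in Abel–Jacobi currency)

Let `C` be a smooth proper curve over an algebraically closed field `k`, `𝒥 : Jacobian C`, `P ∈ C(k)`, `α_P = 𝒥.abelJacobi P : C → J`
(`Q ↦ [Q − P]`), `r + 1 = dim J`, and `Θ₀` an EFFECTIVE Cartier divisor on `J` whose support is EXACTLY the Brill–Noether locus
`W̃_r(P) = {∏_{i ≤ r} α_P(Rᵢ)}` (★ `Jacobian.brillNoetherLocus`; Milne: `Θ = W^{g−1}`).  For `a ∈ J(k)` let
`ι_a := α_P ≫ [−1] ≫ t_a : C → J`, `Q ↦ a · α_P(Q)⁻¹` (Milne's `f⁻¹(Θ_a⁻)`).  THEN there is a non-empty open `U ⊆ J` with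

  **`aj_P(ι_a^♮ Θ₀) = a`** for every `a ∈ U(k)`   (`exists_open_ajSum_classPullback_shear_of_leaves`),

where `aj_P` is the Abel–Jacobi sum (★ `Jacobian.ajSum`, `Motives/JacobianAbelJacobiSum`) and `ι_a^♮` the class pull-back
(★ `CartierDivisor.classPullback`).  Milne: «`f⁻¹(Θ_a⁻) = D(a)` as Cartier divisors for all `a ∈ U`», `f^{(g)}(D(a)) = a`.

## The leaves (hypotheses of this file; their owners in the cell)

* (OPEN+TUPLE) `hopen` — for `a` in a non-empty open `U₁`: `a = ∏_j α_P(τ_j)` for an INJECTIVE tuple `τ : Fin (r+1) → C(k)`, unique up to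
  permutation among all tuples with that product (Milne's `U`: `|D(a)| = {D(a)}`, `D(a)` reduced).  [A-p03 (L-a) ★-pending
  `WeilJacobianStepOneOpen` on Weil's model + A-p14 transport (P0-inj-𝒥).]
* (MULT) `hmult` — for `a` in a non-empty open `U₂`, the honest pull-back `ι_a^* Θ₀` (defined whenever `Θ₀` avoids `ι_a(η_C)`) has ALL
  multiplicities `≤ 1` (road (E): `ψ : C × W̃ → J` is generically étale in characteristic `0`, so its fibres over a dense open are
  reduced — A-p07 (P2b) `Morphisms/EtaleLocusFibres`; reduced subscheme ⟺ `ord ≤ 1` and `Z(ι^*Θ) = C ×_J Z(Θ)` — A-p08/A-p16 (P3)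
  ★ p766585 `CartierDivisorIdealSheafPullback`, `CartierDivisorSubschemeReduced`; `dim W̃_r = r` — A-p14 ★ p766592).
* (ABEL) `hAbel` — `aj_P` is constant on linear equivalence classes [A-p18 road (L) ∕ A-p02 ★ p766444 + `JacobianAbelTheoremOfWeilModel`
  modulo (W1)].
* ★ USED BY NAME: (L-b) `Jacobian.pt_mul_inv_mem_compl_nonvanishing_iff_of_unique` (A-p03, p766252): for such `a, τ`,
  `ι_a(Q) ∈ supp Θ₀ ⟺ Q ∈ {τ_j}`; §0 `ajSum_eq_finset_prod` (p766253); `infinite_algPoints`; class∕honest pull-back comparison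
  `classPullback_linEquiv_pullbackAvoiding`.

## Proof

For `a ∈ U₁ ∩ U₂` (non-empty: `J` is irreducible): some `Q ∉ {τ_j}` exists (`C(k)` is infinite), so `ι_a(Q) ∉ supp Θ₀` by (L-b) and `Θ₀`
avoids `ι_a(η_C)` (supports are closed under specialisation); the honest pull-back `E := ι_a^* Θ₀` is effective, linearly equivalent to
the class pull-back, has `ord_Q E > 0 ⟺ ι_a(Q) ∈ supp Θ₀ ⟺ Q ∈ {τ_j}` (local equations pull back; closed points of a curve have
codimension one) and `ord_Q E ≤ 1` by (MULT); hence `ord_Q E = [Q ∈ {τ_j}]` and `aj_P(ι_a^♮ Θ₀) = aj_P(E) = ∏_j α_P(τ_j) = a`.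

## References
* [Milne1986JacobianVarieties] J. S. Milne, *Jacobian Varieties*, in Cornell–Silverman (eds.), *Arithmetic Geometry* (1986), §6 Lemma 6.7
  (p. 187) and its proof, Thm. 6.6.
* [Lange2023AbelianVarietiesComplex] H. Lange, *Abelian Varieties over the Complex Numbers* (2023), §4.4.2 Lemma 4.4.4 (p. 224), Step I.
-/

set_option autoImplicit false

noncomputable section

universe u

open CategoryTheory CategoryTheory.Limits AlgebraicGeometry MonoidalCategory CartesianMonoidalCategory MonObj
open Literature.AlgebraicGeometry.RelativeSpec

namespace Literature.AlgebraicGeometry.Motives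

open CartierDivisor RatFn

namespace Jacobian

variable {k : Type u} [Field k] [IsAlgClosed k] {C : SchemeOver k} [IsIntegral C.left]
  [SmoothOfRelativeDimension 1 C.hom] [IsProper C.hom] (𝒥 : Jacobian C)

/-! ## §1 Milne's shear `ι_a = t_a ∘ (−1) ∘ α_P : Q ↦ a · α_P(Q)⁻¹` on rational points -/

omit [IsAlgClosed k] [IsIntegral C.left] [SmoothOfRelativeDimension 1 C.hom] [IsProper C.hom] in
/-- **`ι_a(Q) = a · α_P(Q)⁻¹`** on `k`-points: the composite `α_P ≫ [−1] ≫ t_a` (Milne's `Q ↦ a − f(Q)`, the map whose fibre of the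
theta support is `f⁻¹(Θ_a⁻)`; ★ `map_zsmul_id_apply'`, ★ `comp_translation`). [cite: Milne1986JacobianVarieties, §6 Lemma 6.7 (proof)] -/
theorem comp_abelJacobi_neg_translation (P : AlgPoints C k) (a : 𝒥.J.Points k) (Q : AlgPoints C k) :
    Q ≫ 𝒥.abelJacobi P ≫ ((-1 : ℤ) • 𝟙 𝒥.J :).hom.hom.hom ≫ 𝒥.J.translation a = a * (Q ≫ 𝒥.abelJacobi P)⁻¹ := by
  have h1 : (Q ≫ 𝒥.abelJacobi P) ≫ ((-1 : ℤ) • 𝟙 𝒥.J :).hom.hom.hom = (Q ≫ 𝒥.abelJacobi P)⁻¹ := by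
    have := 𝒥.J.map_zsmul_id_apply' k (-1) (Q ≫ 𝒥.abelJacobi P)
    rw [AlgPoints.map_apply, zpow_neg, zpow_one] at this
    exact this
  rw [show Q ≫ 𝒥.abelJacobi P ≫ ((-1 : ℤ) • 𝟙 𝒥.J :).hom.hom.hom ≫ 𝒥.J.translation a =
      ((Q ≫ 𝒥.abelJacobi P) ≫ ((-1 : ℤ) • 𝟙 𝒥.J :).hom.hom.hom) ≫ 𝒥.J.translation a by simp only [Category.assoc],
    h1, AbelianVariety.comp_translation]

omit [IsAlgClosed k] [IsIntegral C.left] [SmoothOfRelativeDimension 1 C.hom] [IsProper C.hom] in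
/-- The underlying point of `C` hit by the scheme morphism `ι_a` at a rational point `Q` is the underlying point of `a · α_P(Q)⁻¹`.
[cite: Milne1986JacobianVarieties, §6 Lemma 6.7 (proof)] -/
theorem shear_base_pt (P : AlgPoints C k) (a : 𝒥.J.Points k) (Q : AlgPoints C k) :
    ((𝒥.abelJacobi P).left ≫ AbelianVariety.Hom.toSchemeHom ((-1 : ℤ) • 𝟙 𝒥.J) ≫ (𝒥.J.translation a).left) Q.pt =
      (a * (Q ≫ 𝒥.abelJacobi P)⁻¹).pt := by
  rw [← 𝒥.comp_abelJacobi_neg_translation P a Q]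
  rfl

/-! ## §2 Supports of honest pull-backs to the curve -/

section Support

variable {X : Scheme.{u}} [IsIntegral X]

omit [IsAlgClosed k] [IsProper C.hom] in
/-- For an effective Cartier divisor `D` on `X`, a morphism `g : C → X` from the smooth curve with `D` avoiding `g(η_C)`, and a closed point
`x` of `C`: **`ord_x(g^*D) > 0 ⟺ g(x) ∈ Supp D`** (the local equation of `g^*D` at `x` is the pulled-back local equation, a non-unit iff
`f_i(g x)` is; closed points of a curve have codimension one). [cite: Milne1986JacobianVarieties, §6 Lemma 6.7 (proof)] -/
theorem ordAt_pullbackAvoiding_pos_iff [IsLocallyNoetherian C.left] (g : C.left ⟶ X) {D : CartierDivisor X} (hD : D.IsEffective)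
    (hDg : D.Avoids (g (genericPoint C.left))) {x : C.left} (hx : x ≠ genericPoint C.left) :
    0 < (D.pullbackAvoiding g hDg).ordAt x ↔ g x ∈ (D.nonvanishing 1)ᶜ := by
  haveI := CurvePlaces.isDiscreteValuationRing_stalk C hx
  constructor
  · intro hpos hmem
    have hav : D.Avoids (g x) := (avoids_iff_mem_nonvanishing_one).mpr (by simpa using hmem)
    have hav' : (D.pullbackAvoiding g hDg).Avoids x := fun i hi => (hav i.1 hi).pullbackFn
    have h0 := hav'.ordAt_eq_zero
    omega
  · intro hmem
    obtain ⟨i, hi⟩ := (D.pullbackAvoiding g hDg).covers x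
    have hnot : ¬ IsUnitAt (g x) (D.f i.1) := by
      intro hu
      apply hmem
      exact (D.mem_nonvanishing_iff (s := 1) hi).mpr (by rw [_root_.mul_one]; exact hu)
    exact (hD.pullbackAvoiding g hDg).ordAt_pos hi (hD.not_isUnitAt_pullbackAvoiding g hDg i hi hnot)
      (CurvePlaces.coheight_eq_one_of_isDiscreteValuationRing)

end Support

/-! ## §3 Step I assembled from its leaves -/

/-- **STEP I OF LANGE'S LEMMA 4.4.4 ∕ MILNE'S LEMMA 6.7, FROM ITS LEAVES** (letter (M″) of `G4.sockets.v5`, conditional form): for a smooth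
proper curve `C` over an algebraically closed field, a Jacobian `𝒥`, a base point `P`, any `r` (in the application `r + 1 = dim J`), an
effective divisor `Θ₀` on `J` with support exactly `W̃_r(P)`, and GIVEN (OPEN+TUPLE) `hopen`, (MULT) `hmult` and (ABEL) `hAbel` (module docstring), there is a non-empty
open `U ⊆ J` such that **`aj_P(ι_a^♮ Θ₀) = a`** for all `a ∈ U(k)`, `ι_a = α_P ≫ [−1] ≫ t_a`.
[cite: Milne1986JacobianVarieties, §6 Lemma 6.7 (p. 187) and its proof] [cite: Lange2023AbelianVarietiesComplex, §4.4.2 Lemma 4.4.4 (p. 224)] -/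
theorem exists_open_ajSum_classPullback_shear_of_leaves [IsLocallyNoetherian C.left]
    (P : AlgPoints C k) (r : ℕ)
    {Θ₀ : CartierDivisor 𝒥.J.X.left} (h0 : Θ₀.IsEffective) (hsupp : (Θ₀.nonvanishing 1)ᶜ = 𝒥.brillNoetherLocus P r)
    (hopen : ∃ U₁ : 𝒥.J.X.left.Opens, (U₁ : Set 𝒥.J.X.left).Nonempty ∧
      ∀ a : 𝒥.J.Points k, a.pt ∈ U₁ → ∃ τ : Fin (r + 1) → AlgPoints C k, Function.Injective τ ∧
        (∏ j : Fin (r + 1), τ j ≫ 𝒥.abelJacobi P) = a ∧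
        ∀ τ' : Fin (r + 1) → AlgPoints C k, (∏ j : Fin (r + 1), τ' j ≫ 𝒥.abelJacobi P) = a →
          ∃ σ : Equiv.Perm (Fin (r + 1)), τ' = τ ∘ σ)
    (hmult : ∃ U₂ : 𝒥.J.X.left.Opens, (U₂ : Set 𝒥.J.X.left).Nonempty ∧
      ∀ a : 𝒥.J.Points k, a.pt ∈ U₂ →
        ∀ hav : Θ₀.Avoids (((𝒥.abelJacobi P).left ≫ AbelianVariety.Hom.toSchemeHom ((-1 : ℤ) • 𝟙 𝒥.J) ≫
            (𝒥.J.translation a).left) (genericPoint C.left)),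
        ∀ Q : AlgPoints C k,
          (Θ₀.pullbackAvoiding ((𝒥.abelJacobi P).left ≫ AbelianVariety.Hom.toSchemeHom ((-1 : ℤ) • 𝟙 𝒥.J) ≫
            (𝒥.J.translation a).left) hav).ordAt Q.pt ≤ 1)
    (hAbel : ∀ E F : CartierDivisor C.left, E.LinEquiv F → 𝒥.ajSum P E = 𝒥.ajSum P F) :
    ∃ U : 𝒥.J.X.left.Opens, (U : Set 𝒥.J.X.left).Nonempty ∧
      ∀ a : 𝒥.J.Points k, a.pt ∈ U →
        𝒥.ajSum P (Θ₀.classPullback ((𝒥.abelJacobi P).left ≫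
          AbelianVariety.Hom.toSchemeHom ((-1 : ℤ) • 𝟙 𝒥.J) ≫ (𝒥.J.translation a).left)) = a := by
  classical
  obtain ⟨U₁, hU₁, h1⟩ := hopen
  obtain ⟨U₂, hU₂, h2⟩ := hmult
  -- `J` is irreducible, so the two non-empty opens meet
  haveI : IsIntegral 𝒥.J.X.left := GeometricallyIntegral.isIntegral_of_subsingleton 𝒥.J.X.hom
  have hU : ((U₁ ⊓ U₂ : 𝒥.J.X.left.Opens) : Set 𝒥.J.X.left).Nonempty := by
    rw [TopologicalSpace.Opens.coe_inf]
    exact nonempty_preirreducible_inter U₁.2 U₂.2 hU₁ hU₂ |>.imp fun x hx => hx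
  refine ⟨U₁ ⊓ U₂, hU, fun a ha' => ?_⟩
  have ha : a.pt ∈ (U₁ : Set 𝒥.J.X.left) ∧ a.pt ∈ (U₂ : Set 𝒥.J.X.left) := TopologicalSpace.Opens.mem_inf.mp ha'
  obtain ⟨τ, hτinj, hτ, huniq⟩ := h1 a ha.1
  set ia : C.left ⟶ 𝒥.J.X.left := (𝒥.abelJacobi P).left ≫ AbelianVariety.Hom.toSchemeHom ((-1 : ℤ) • 𝟙 𝒥.J) ≫
    (𝒥.J.translation a).left with hia
  -- (L-b): the rational points `Q` with `ι_a(Q) ∈ supp Θ₀` are exactly the `τ_j`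
  have hLb : ∀ Q : AlgPoints C k, ia Q.pt ∈ (Θ₀.nonvanishing 1)ᶜ ↔ Q ∈ Set.range τ := by
    intro Q
    rw [hia, 𝒥.shear_base_pt P a Q]
    exact 𝒥.pt_mul_inv_mem_compl_nonvanishing_iff_of_unique P τ a hτ huniq hsupp Q
  -- a rational point `Q₀` off the tuple: `C(k)` is infinite
  haveI := infinite_algPoints C
  obtain ⟨Q₀, hQ₀⟩ : ∃ Q₀ : AlgPoints C k, Q₀ ∉ Set.range τ := ((Set.finite_range τ).infinite_compl).nonempty
  -- hence `Θ₀` avoids `ι_a(η_C)` (the support is closed under specialisation)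
  have hav : Θ₀.Avoids (ia (genericPoint C.left)) := by
    have hQ₀' : ia Q₀.pt ∉ (Θ₀.nonvanishing 1)ᶜ := fun h => hQ₀ ((hLb Q₀).mp h)
    have hQ₀'' : ia Q₀.pt ∈ Θ₀.nonvanishing 1 := by
      by_contra hn
      exact hQ₀' hn
    have havQ : Θ₀.Avoids (ia Q₀.pt) := (avoids_iff_mem_nonvanishing_one).mpr hQ₀''
    exact Avoids.of_specializes (((genericPoint_spec C.left).specializes (Set.mem_univ Q₀.pt)).map ia.continuous) havQ
  -- the honest pull-back `E = ι_a^* Θ₀`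
  set E := Θ₀.pullbackAvoiding ia hav with hE
  have hEeff : E.IsEffective := h0.pullbackAvoiding ia hav
  have hle : ∀ Q : AlgPoints C k, E.ordAt Q.pt ≤ 1 := fun Q => h2 a ha.2 hav Q
  -- the multiplicities of `E`: `1` on the tuple, `0` elsewhere
  have hQgen : ∀ Q : AlgPoints C k, Q.pt ≠ genericPoint C.left := fun Q hgen => by
    -- a rational point is closed; were it generic, `C` would be a single point, against `C(k)` infinite
    have hcl : IsClosed ({Q.pt} : Set C.left) := Q.isClosed_singleton_pt
    have huniv : ({Q.pt} : Set C.left) = Set.univ := by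
      rw [← hcl.closure_eq, hgen]
      exact genericPoint_spec C.left
    have hsub : Function.Injective (fun R : AlgPoints C k => R.pt) := fun R R' h => AlgPoints.eq_of_pt_eq h
    apply Set.infinite_univ (α := AlgPoints C k)
    refine Set.Finite.of_finite_image ?_ hsub.injOn
    exact (Set.finite_singleton Q.pt).subset (fun x _ => by rw [huniv]; trivial)
  have hord : ∀ Q : AlgPoints C k, E.ordAt Q.pt = if Q ∈ Set.range τ then 1 else 0 := by
    intro Q
    have hpos := ordAt_pullbackAvoiding_pos_iff ia h0 hav (hQgen Q)
    rw [← hE] at hpos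
    by_cases hQ : Q ∈ Set.range τ
    · rw [if_pos hQ]
      have h1' : 0 < E.ordAt Q.pt := hpos.mpr ((hLb Q).mpr hQ)
      have h2' := hle Q
      omega
    · rw [if_neg hQ]
      have hn : ¬ 0 < E.ordAt Q.pt := fun h => hQ ((hLb Q).mp (hpos.mp h))
      have h0' := hEeff.ordAt_nonneg Q.pt
      omega
  -- `aj_P(ι^♮ Θ₀) = aj_P(E)` (ABEL) `= ∏_j α_P(τ_j)` (the multiplicities) `= a`
  have hlin : (Θ₀.classPullback ia).LinEquiv E := Θ₀.classPullback_linEquiv_pullbackAvoiding ia hav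
  rw [hAbel _ _ hlin, 𝒥.ajSum_eq_finset_prod P E (Finset.univ.image τ) (fun Q hQ => by
    rw [hord] at hQ
    split_ifs at hQ with hmem
    · obtain ⟨j, rfl⟩ := hmem
      exact Finset.mem_image_of_mem τ (Finset.mem_univ j)
    · exact absurd rfl hQ)]
  rw [Finset.prod_image (fun j _ j' _ h => hτinj h), ← hτ]
  refine Finset.prod_congr rfl fun j _ => ?_
  rw [hord, if_pos ⟨j, rfl⟩, zpow_one, AlgPoints.map_apply]

end Jacobian

end Literature.AlgebraicGeometry.Motives

end
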